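import Mathlib
import Literature.Barriers.ValiantsHypothesis.AlgebraicNaturalProofs
import Literature.Computability.AlgebraicComplexity.ArithCircuitProofs
import Summits.ValiantsHypothesis.ValiantsHypothesis.Theorems.BarrierLeverPartitionMinorsHitByVPAutomorphicLayouts
import Summits.ValiantsHypothesis.ValiantsHypothesis.Theorems.BarrierLeverPartitionMinorsHitByVPPiecewiseAutomorphic

/-!
# Route BarrierLever — item `PartitionMinorsHitByVP` (stmt-ValiantsHypothesis-19717):
# MATCHED PAIRS DROP OUT (exact-pattern peeling, one parameter, no thresholds)

Helper file (`--supports stmt-ValiantsHypothesis-19717`; cell valiant-natproofs, rung V4, 𝒟-side,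
prover seat val-np-p3 gen 2). Definition-free. Closes NO item.

The split door (`…SplitDoor.partitionMinor_hit_of_split`, prover gen 6) glues two ARBITRARY
sub-witnesses along a pair of LINEAR THRESHOLD cells. This file is the complementary, threshold-free
gluing: if a witness `g` has its layout matrix SUPPORTED on a cell `S × T` (zero outside) and
nonsingular there (through a bijection `e : S ≃ T`), and an arbitrary `f₂` is nonsingular on the
complementary cell `Sᶜ × Tᶜ`, then `g + c · f₂` is nonsingular on the whole layout for all but
finitely many `c` — because `det (D + c·B) = c^{|Sᶜ|} · q(c)` with `q(0)` block lower-triangular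
(`= det D_{S,T} · det B_{Sᶜ,Tᶜ} ≠ 0`). The typical `g` is the twisted diagonal state of a cube
automorphism `Φ = σ ∘ (· ∆ s)` (`…Automorphic`, prover gen 6), whose layout matrix is the 0/1
matrix `[W_j = Φ(U_i)]`: the `Φ`-MATCHED PAIRS of a layout drop out, no geometry required.

* `det_blockTriangular_of_split_ne_zero` — block lower-triangular determinant through a split.
* `exists_det_add_smul_ne_zero` — the one-parameter engine.
* **`partitionMinor_hit_of_peel`** — `g` supported and nonsingular on `S × T`, `f₂` nonsingular on
  `Sᶜ × Tᶜ`, both in `SmallCircuits ℂ (h+h) b` ⇒ some `f ∈ SmallCircuits ℂ (h+h) (b+1)` works.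
* **`partitionMinor_hit_of_automorphicPeel`** — the matched pairs `W_j = σ((U_i) ∆ s)` drop out.
* **`partitionMinor_hit_of_commonPeel`** — the COMMON MEMBERS `W_j = U_i` drop out.
* **`partitionMinorsHitByVP_of_commonFree`** — the statement of item `PartitionMinorsHitByVP`
  (spelled out verbatim; the companion file `…MatchedPairsDropOutAssembled` restates it against the
  route declaration) follows from its restriction to layouts with NO common member (`u i ≠ w j` for
  all `i, j`), exponent `b ↦ max b 2 + 1`.

WHAT THIS IS NOT: the common-free (a fortiori Φ-derangement) layouts are exactly the open residue;
nothing on crux 14610 / FSV Question 6; VP vs VNP untouched.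
-/

set_option linter.dupNamespace false

namespace Summit.ValiantsHypothesis.ValiantsHypothesis.Theorems.BarrierLever.MatchedPairs

open Finset Polynomial
open Literature.Barriers.ValiantsHypothesis Literature.Computability.AlgebraicComplexity
open Summit.ValiantsHypothesis.ValiantsHypothesis.Theorems.BarrierLever.Automorphic
  (coeff_twistedDiag twistedDiag_mem_smallCircuits)
open Summit.ValiantsHypothesis.ValiantsHypothesis.Theorems.BarrierLever.SplitDoor
  (cell_det_twistedDiag_ne_zero)

/-! ## 1. The one-parameter engine -/

section Engine

variable {r : ℕ}

/-- **Block lower-triangular determinant through a split.** If `p` is nonsingular on `S × T`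
(through `e : S ≃ T`) and `q` on `Sᶜ × Tᶜ` (through `e'`), then the matrix agreeing with `p` on
`S × T`, equal to `0` on `S × Tᶜ` and to `q` on the rows of `Sᶜ` is nonsingular. -/
theorem det_blockTriangular_of_split_ne_zero (p q : Matrix (Fin r) (Fin r) ℂ) (S T : Finset (Fin r))
    (e : {i // i ∈ S} ≃ {j // j ∈ T}) (e' : {i // i ∉ S} ≃ {j // j ∉ T})
    (hp : (Matrix.of fun i i' : {i // i ∈ S} => p i (e i')).det ≠ 0)
    (hq : (Matrix.of fun i i' : {i // i ∉ S} => q i (e' i')).det ≠ 0) :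
    (Matrix.of fun i j : Fin r => if i ∈ S then (if j ∈ T then p i j else 0) else q i j).det ≠ 0 := by
  classical
  set G : Matrix (Fin r) (Fin r) ℂ := Matrix.of fun i j : Fin r =>
      if i ∈ S then (if j ∈ T then p i j else 0) else q i j with hG
  let κ : Equiv.Perm (Fin r) :=
    (Equiv.sumCompl (fun i : Fin r => i ∈ S)).symm.trans
      ((e.sumCongr e').trans (Equiv.sumCompl (fun j : Fin r => j ∈ T)))
  have hκS : ∀ i : {i // i ∈ S}, κ i = e i := fun i => by
    simp [κ, Equiv.sumCompl_symm_apply_of_pos i.2]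
  have hκS' : ∀ i : {i // i ∉ S}, κ i = e' i := fun i => by
    simp [κ, Equiv.sumCompl_symm_apply_of_neg i.2]
  set H : Matrix (Fin r) (Fin r) ℂ := G.submatrix id κ with hH
  have hdetH : H.det = Equiv.Perm.sign κ * G.det := by
    rw [hH, Matrix.det_permute']
  let eS := (Equiv.sumCompl (fun i : Fin r => i ∈ S)).symm
  have hblocks : H.reindex eS eS =
      Matrix.fromBlocks (Matrix.of fun i i' : {i // i ∈ S} => p i (e i')) 0
        (Matrix.of fun (i : {i // i ∉ S}) (i' : {i // i ∈ S}) => q i (e i'))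
        (Matrix.of fun i i' : {i // i ∉ S} => q i (e' i')) := by
    ext x y
    rw [Matrix.reindex_apply, Matrix.submatrix_apply]
    rcases x with x | x <;> rcases y with y | y
    · simp only [eS, Equiv.symm_symm, Equiv.sumCompl_apply_inl, Matrix.fromBlocks_apply₁₁,
        Matrix.of_apply, hH, Matrix.submatrix_apply, id, hκS, hG]
      rw [if_pos x.2, if_pos (e y).2]
    · simp only [eS, Equiv.symm_symm, Equiv.sumCompl_apply_inl, Equiv.sumCompl_apply_inr,
        Matrix.fromBlocks_apply₁₂, Matrix.zero_apply, hH, Matrix.submatrix_apply, id, hκS', hG,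
        Matrix.of_apply]
      rw [if_pos x.2, if_neg (e' y).2]
    · simp only [eS, Equiv.symm_symm, Equiv.sumCompl_apply_inl, Equiv.sumCompl_apply_inr,
        Matrix.fromBlocks_apply₂₁, hH, Matrix.submatrix_apply, id, hκS, hG,
        Matrix.of_apply]
      rw [if_neg x.2]
    · simp only [eS, Equiv.symm_symm, Equiv.sumCompl_apply_inr, Matrix.fromBlocks_apply₂₂,
        Matrix.of_apply, hH, Matrix.submatrix_apply, id, hκS', hG]
      rw [if_neg x.2]
  have hdetH' : (H.reindex eS eS).det = H.det := Matrix.det_reindex_self eS H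
  rw [hblocks, Matrix.det_fromBlocks_zero₁₂] at hdetH'
  intro hG0
  rw [hG0, mul_zero] at hdetH
  rw [hdetH] at hdetH'
  exact mul_ne_zero hp hq hdetH'

/-- **The one-parameter engine.** `D` vanishes outside `S × T` and is nonsingular on it (through
`e`), `B` is nonsingular on `Sᶜ × Tᶜ` (through `e'`); then `det (D + c • B) ≠ 0` for some `c`.
Proof: `D + c • B = diag(1_S, c·1_{Sᶜ}) · Q(c)` with `Q(X)_{ij} = D_{ij} + (i ∈ S ? X : 1) · B_{ij}`
a polynomial matrix whose value at `X = 0` is block lower-triangular. -/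
theorem exists_det_add_smul_ne_zero (D B : Matrix (Fin r) (Fin r) ℂ) (S T : Finset (Fin r))
    (e : {i // i ∈ S} ≃ {j // j ∈ T}) (e' : {i // i ∉ S} ≃ {j // j ∉ T})
    (hD : ∀ i j, ¬ (i ∈ S ∧ j ∈ T) → D i j = 0)
    (hp : (Matrix.of fun i i' : {i // i ∈ S} => D i (e i')).det ≠ 0)
    (hq : (Matrix.of fun i i' : {i // i ∉ S} => B i (e' i')).det ≠ 0) :
    ∃ c : ℂ, (D + c • B).det ≠ 0 := by
  classical
  -- the polynomial matrix
  set Q : Matrix (Fin r) (Fin r) ℂ[X] :=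
    Matrix.of fun i j => C (D i j) + (if i ∈ S then X else 1) * C (B i j) with hQ
  have hev : ∀ c : ℂ, Q.map (Polynomial.eval c) =
      Matrix.of fun i j => D i j + (if i ∈ S then c else 1) * B i j := by
    intro c
    ext i j
    simp only [hQ, Matrix.map_apply, Matrix.of_apply, eval_add, eval_mul, eval_C]
    by_cases hi : i ∈ S
    · rw [if_pos hi, if_pos hi, eval_X]
    · rw [if_neg hi, if_neg hi, eval_one]
  have hdet_ev : ∀ c : ℂ, (Q.map (Polynomial.eval c)).det = (Q.det).eval c := fun c =>
    (RingHom.map_det (Polynomial.evalRingHom c) Q).symm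
  -- at X = 0 the matrix is block lower-triangular
  have h0 : (Q.map (Polynomial.eval 0)).det ≠ 0 := by
    have hM : Q.map (Polynomial.eval 0) =
        Matrix.of fun i j : Fin r => if i ∈ S then (if j ∈ T then D i j else 0) else B i j := by
      rw [hev]
      ext i j
      simp only [Matrix.of_apply]
      by_cases hi : i ∈ S
      · rw [if_pos hi, if_pos hi, zero_mul, add_zero]
        by_cases hj : j ∈ T
        · rw [if_pos hj]
        · rw [if_neg hj, hD i j (fun hh => hj hh.2)]
      · rw [if_neg hi, if_neg hi, one_mul, hD i j (fun hh => hi hh.1), zero_add]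
    rw [hM]
    exact det_blockTriangular_of_split_ne_zero D B S T e e' hp hq
  have hQne : Q.det ≠ 0 := by
    intro hz
    apply h0
    rw [hdet_ev, hz, eval_zero]
  -- a value of c off the roots and off 0
  obtain ⟨c, hc⟩ := Infinite.exists_notMem_finset (Q.det.roots.toFinset ∪ {0})
  rw [Finset.mem_union, Finset.mem_singleton, Multiset.mem_toFinset, not_or] at hc
  have hc0 : c ≠ 0 := hc.2
  have hQc : (Q.map (Polynomial.eval c)).det ≠ 0 := by
    rw [hdet_ev]
    intro hz
    exact hc.1 ((Polynomial.mem_roots hQne).mpr hz)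
  refine ⟨c, ?_⟩
  -- D + c • B = diagonal v * Q(c)
  have hfac : D + c • B = Matrix.diagonal (fun i => if i ∈ S then (1 : ℂ) else c) *
      Q.map (Polynomial.eval c) := by
    rw [hev]
    ext i j
    rw [Matrix.diagonal_mul, Matrix.add_apply, Matrix.smul_apply, Matrix.of_apply, smul_eq_mul]
    by_cases hi : i ∈ S
    · rw [if_pos hi, if_pos hi, one_mul]
    · rw [if_neg hi, if_neg hi, hD i j (fun hh => hi hh.1), one_mul, zero_add, zero_add]
  rw [hfac, Matrix.det_mul, Matrix.det_diagonal]
  refine mul_ne_zero (Finset.prod_ne_zero_iff.mpr fun i _ => ?_) hQc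
  by_cases hi : i ∈ S
  · rw [if_pos hi]; exact one_ne_zero
  · rw [if_neg hi]; exact hc0

end Engine

/-! ## 2. Peeling a supported nonsingular block off a layout -/

variable {h r : ℕ}

/-- **Exact-pattern peeling.** Layout `(u, w)`; cells `S × T` (bijection `e`) and `Sᶜ × Tᶜ`
(bijection `e'`). If `g ∈ SmallCircuits ℂ (h+h) b₀` has layout matrix supported on `S × T` and
nonsingular there, and `f₂ ∈ SmallCircuits ℂ (h+h) b₀` is nonsingular on `Sᶜ × Tᶜ`, then some
`f = g + c · f₂ ∈ SmallCircuits ℂ (h+h) (b₀+1)` is nonsingular on the whole layout (`h ≥ 2`). -/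
theorem partitionMinor_hit_of_peel (b₀ : ℕ) (hh : 2 ≤ h) (u w : Fin r → Finset (Fin h))
    (S T : Finset (Fin r)) (e : {i // i ∈ S} ≃ {j // j ∈ T}) (e' : {i // i ∉ S} ≃ {j // j ∉ T})
    (g f₂ : MvPolynomial (Fin (h + h)) ℂ)
    (hg : g ∈ SmallCircuits ℂ (h + h) b₀) (hf₂ : f₂ ∈ SmallCircuits ℂ (h + h) b₀)
    (hoff : ∀ i j : Fin r, ¬ (i ∈ S ∧ j ∈ T) → MvPolynomial.coeff
        (∑ a ∈ u i, Finsupp.single (Fin.castAdd h a) 1 +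
          ∑ c ∈ w j, Finsupp.single (Fin.natAdd h c) 1) g = 0)
    (hp : (Matrix.of fun i i' : {i // i ∈ S} => MvPolynomial.coeff
        (∑ a ∈ u i.1, Finsupp.single (Fin.castAdd h a) 1 +
          ∑ c ∈ w (e i').1, Finsupp.single (Fin.natAdd h c) 1) g).det ≠ 0)
    (hq : (Matrix.of fun i i' : {i // i ∉ S} => MvPolynomial.coeff
        (∑ a ∈ u i.1, Finsupp.single (Fin.castAdd h a) 1 +
          ∑ c ∈ w (e' i').1, Finsupp.single (Fin.natAdd h c) 1) f₂).det ≠ 0) :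
    ∃ f ∈ SmallCircuits ℂ (h + h) (b₀ + 1),
      (Matrix.of fun i j : Fin r => MvPolynomial.coeff
        (∑ a ∈ u i, Finsupp.single (Fin.castAdd h a) 1 +
          ∑ c ∈ w j, Finsupp.single (Fin.natAdd h c) 1) f).det ≠ 0 := by
  classical
  set D : Matrix (Fin r) (Fin r) ℂ := Matrix.of fun i j : Fin r => MvPolynomial.coeff
      (∑ a ∈ u i, Finsupp.single (Fin.castAdd h a) 1 + ∑ c ∈ w j, Finsupp.single (Fin.natAdd h c) 1) g
    with hDdef
  set B : Matrix (Fin r) (Fin r) ℂ := Matrix.of fun i j : Fin r => MvPolynomial.coeff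
      (∑ a ∈ u i, Finsupp.single (Fin.castAdd h a) 1 + ∑ c ∈ w j, Finsupp.single (Fin.natAdd h c) 1) f₂
    with hBdef
  obtain ⟨c, hc⟩ := exists_det_add_smul_ne_zero D B S T e e'
    (fun i j hij => by rw [hDdef, Matrix.of_apply]; exact hoff i j hij)
    (by simpa only [hDdef, Matrix.of_apply] using hp) (by simpa only [hBdef, Matrix.of_apply] using hq)
  refine ⟨g + MvPolynomial.C c * f₂, ⟨?_, ?_⟩, ?_⟩
  · -- degree
    refine (MvPolynomial.totalDegree_add _ _).trans (max_le hg.1 ?_)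
    exact (MvPolynomial.totalDegree_mul _ _).trans (by rw [MvPolynomial.totalDegree_C, zero_add]; exact hf₂.1)
  · -- size
    calc complexity (g + MvPolynomial.C c * f₂)
        ≤ complexity g + complexity (MvPolynomial.C c * f₂) + 1 := complexity_add_le_holds _ _
      _ ≤ complexity g + (complexity (MvPolynomial.C c : MvPolynomial (Fin (h + h)) ℂ) +
            complexity f₂ + 1) + 1 := by
          gcongr
          exact complexity_mul_le_holds _ _
      _ ≤ (h + h) ^ b₀ + (0 + (h + h) ^ b₀ + 1) + 1 := by
          gcongr
          · exact hg.2
          · exact (complexity_C_holds _).le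
          · exact hf₂.2
      _ ≤ (h + h) ^ (b₀ + 1) := by
          have h4 : 4 ≤ h + h := by omega
          have h1 : 1 ≤ (h + h) ^ b₀ := Nat.one_le_pow _ _ (by omega)
          calc (h + h) ^ b₀ + (0 + (h + h) ^ b₀ + 1) + 1 = 2 * (h + h) ^ b₀ + 2 := by ring
            _ ≤ 4 * (h + h) ^ b₀ := by linarith
            _ ≤ (h + h) * (h + h) ^ b₀ := Nat.mul_le_mul_right _ h4
            _ = (h + h) ^ (b₀ + 1) := by ring
  · -- the layout matrix of `g + C c * f₂` is `D + c • B`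
    have hM : (Matrix.of fun i j : Fin r => MvPolynomial.coeff
        (∑ a ∈ u i, Finsupp.single (Fin.castAdd h a) 1 + ∑ c ∈ w j, Finsupp.single (Fin.natAdd h c) 1)
        (g + MvPolynomial.C c * f₂)) = D + c • B := by
      ext i j
      rw [Matrix.of_apply, MvPolynomial.coeff_add, MvPolynomial.coeff_C_mul, Matrix.add_apply,
        Matrix.smul_apply, hDdef, hBdef, Matrix.of_apply, Matrix.of_apply, smul_eq_mul]
    rw [hM]
    exact hc

/-- **The matched pairs of a cube automorphism drop out.** Let `Φ(U) = σ(U ∆ s)`. If the cell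
`S × T` consists of `Φ`-matched pairs (`w (e i) = Φ(u i)` for `i ∈ S`), no other entry of the layout
is `Φ`-matched, the rows are distinct, and some `f₂ ∈ SmallCircuits ℂ (h+h) b₀` (`b₀ ≥ 2`) is
nonsingular on `Sᶜ × Tᶜ`, then the layout is hit in `SmallCircuits ℂ (h+h) (b₀+1)` (`h ≥ 2`). -/
theorem partitionMinor_hit_of_automorphicPeel (b₀ : ℕ) (hh : 2 ≤ h) (hb₀ : 2 ≤ b₀)
    (u w : Fin r → Finset (Fin h)) (hu : Function.Injective u)
    (σ : Equiv.Perm (Fin h)) (s : Finset (Fin h))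
    (S T : Finset (Fin r)) (e : {i // i ∈ S} ≃ {j // j ∈ T}) (e' : {i // i ∉ S} ≃ {j // j ∉ T})
    (hw : ∀ i : {i // i ∈ S}, w (e i).1 = (symmDiff (u i.1) s).image σ)
    (hoff : ∀ i j : Fin r, ¬ (i ∈ S ∧ j ∈ T) → w j ≠ (symmDiff (u i) s).image σ)
    (f₂ : MvPolynomial (Fin (h + h)) ℂ) (hf₂ : f₂ ∈ SmallCircuits ℂ (h + h) b₀)
    (hq : (Matrix.of fun i i' : {i // i ∉ S} => MvPolynomial.coeff
        (∑ a ∈ u i.1, Finsupp.single (Fin.castAdd h a) 1 +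
          ∑ c ∈ w (e' i').1, Finsupp.single (Fin.natAdd h c) 1) f₂).det ≠ 0) :
    ∃ f ∈ SmallCircuits ℂ (h + h) (b₀ + 1),
      (Matrix.of fun i j : Fin r => MvPolynomial.coeff
        (∑ a ∈ u i, Finsupp.single (Fin.castAdd h a) 1 +
          ∑ c ∈ w j, Finsupp.single (Fin.natAdd h c) 1) f).det ≠ 0 := by
  classical
  have h1 : 1 ≤ h := by omega
  refine partitionMinor_hit_of_peel b₀ hh u w S T e e' _ f₂
    (⟨(twistedDiag_mem_smallCircuits h1 σ s).1, (twistedDiag_mem_smallCircuits h1 σ s).2.trans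
      (Nat.pow_le_pow_right (by omega) hb₀)⟩) hf₂ ?_ ?_ hq
  · intro i j hij
    rw [coeff_twistedDiag, if_neg (hoff i j hij)]
  · have hc := cell_det_twistedDiag_ne_zero u w hu e σ s hw
    convert hc using 2

/-- **Common members drop out.** If the cell `S × T` consists of the common members
(`w (e i) = u i` for `i ∈ S`), no other entry has `w j = u i`, the rows are distinct, and some
`f₂ ∈ SmallCircuits ℂ (h+h) b₀` (`b₀ ≥ 2`) is nonsingular on `Sᶜ × Tᶜ`, then the layout is hit
in `SmallCircuits ℂ (h+h) (b₀+1)` (`h ≥ 2`): the diagonal state `∏ (1 + x_a y_a)` absorbs them. -/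
theorem partitionMinor_hit_of_commonPeel (b₀ : ℕ) (hh : 2 ≤ h) (hb₀ : 2 ≤ b₀)
    (u w : Fin r → Finset (Fin h)) (hu : Function.Injective u)
    (S T : Finset (Fin r)) (e : {i // i ∈ S} ≃ {j // j ∈ T}) (e' : {i // i ∉ S} ≃ {j // j ∉ T})
    (hw : ∀ i : {i // i ∈ S}, w (e i).1 = u i.1)
    (hoff : ∀ i j : Fin r, ¬ (i ∈ S ∧ j ∈ T) → w j ≠ u i)
    (f₂ : MvPolynomial (Fin (h + h)) ℂ) (hf₂ : f₂ ∈ SmallCircuits ℂ (h + h) b₀)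
    (hq : (Matrix.of fun i i' : {i // i ∉ S} => MvPolynomial.coeff
        (∑ a ∈ u i.1, Finsupp.single (Fin.castAdd h a) 1 +
          ∑ c ∈ w (e' i').1, Finsupp.single (Fin.natAdd h c) 1) f₂).det ≠ 0) :
    ∃ f ∈ SmallCircuits ℂ (h + h) (b₀ + 1),
      (Matrix.of fun i j : Fin r => MvPolynomial.coeff
        (∑ a ∈ u i, Finsupp.single (Fin.castAdd h a) 1 +
          ∑ c ∈ w j, Finsupp.single (Fin.natAdd h c) 1) f).det ≠ 0 := by
  classical
  have hid : ∀ U : Finset (Fin h), (symmDiff U ∅).image (Equiv.refl (Fin h)) = U := by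
    intro U
    simp
  refine partitionMinor_hit_of_automorphicPeel b₀ hh hb₀ u w hu (Equiv.refl _) ∅ S T e e'
    (fun i => by rw [hid]; exact hw i) (fun i j hij => by rw [hid]; exact hoff i j hij) f₂ hf₂ hq

/-! ## 3. Reduction of the item to common-free layouts -/

/-- **Item `PartitionMinorsHitByVP` reduces to COMMON-FREE layouts.** If, for some `b` and all
large `h`, every injective layout WITHOUT common members (`u i ≠ w j` for all `i, j`) is hit by
`SmallCircuits ℂ (h+h) b`, then the statement of `PartitionMinorsHitByVP` (route BarrierLever,
spelled out verbatim) holds, with exponent `max b 2 + 1`. -/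
theorem partitionMinorsHitByVP_of_commonFree
    (hcf : ∃ b h₀ : ℕ, ∀ h : ℕ, h₀ ≤ h → ∀ (r : ℕ) (u w : Fin r → Finset (Fin h)),
      Function.Injective u → Function.Injective w → (∀ i j, u i ≠ w j) →
      ∃ f ∈ SmallCircuits ℂ (h + h) b,
        (Matrix.of fun i j : Fin r => MvPolynomial.coeff
          (∑ a ∈ u i, Finsupp.single (Fin.castAdd h a) 1 +
            ∑ c ∈ w j, Finsupp.single (Fin.natAdd h c) 1) f).det ≠ 0) :
    ∃ b h₀ : ℕ, ∀ h : ℕ, h₀ ≤ h → ∀ (r : ℕ) (u w : Fin r → Finset (Fin h)),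
      Function.Injective u → Function.Injective w →
      ∃ f ∈ Literature.Barriers.ValiantsHypothesis.SmallCircuits ℂ (h + h) b,
        (Matrix.of fun i j : Fin r => MvPolynomial.coeff
          (∑ a ∈ u i, Finsupp.single (Fin.castAdd h a) 1 +
            ∑ c ∈ w j, Finsupp.single (Fin.natAdd h c) 1) f).det ≠ 0 := by
  classical
  obtain ⟨b, h₀, hcf⟩ := hcf
  refine ⟨max b 2 + 1, max h₀ 2, fun h hh r u w hu hw => ?_⟩
  have hh₀ : h₀ ≤ h := le_trans (le_max_left _ _) hh
  have hh2 : 2 ≤ h := le_trans (le_max_right _ _) hh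
  -- the matched (common) rows and columns
  set S : Finset (Fin r) := Finset.univ.filter fun i => ∃ j, w j = u i with hS
  set T : Finset (Fin r) := Finset.univ.filter fun j => ∃ i, w j = u i with hT
  have hSmem : ∀ i, i ∈ S ↔ ∃ j, w j = u i := fun i => by simp [hS]
  have hTmem : ∀ j, j ∈ T ↔ ∃ i, w j = u i := fun j => by simp [hT]
  -- the matching e : S ≃ T
  have hex : ∀ i : {i // i ∈ S}, ∃ j, w j = u i.1 := fun i => (hSmem i.1).mp i.2
  let eto : {i // i ∈ S} → {j // j ∈ T} := fun i =>
    ⟨Classical.choose (hex i), (hTmem _).mpr ⟨i.1, Classical.choose_spec (hex i)⟩⟩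
  have heto : ∀ i : {i // i ∈ S}, w (eto i).1 = u i.1 := fun i => Classical.choose_spec (hex i)
  have hinj : Function.Injective eto := by
    intro i i' hii'
    apply Subtype.ext
    apply hu
    rw [← heto i, ← heto i', hii']
  have hsurj : Function.Surjective eto := by
    intro j
    obtain ⟨i, hi⟩ := (hTmem j.1).mp j.2
    refine ⟨⟨i, (hSmem i).mpr ⟨j.1, hi⟩⟩, Subtype.ext (hw ?_)⟩
    rw [heto, hi]
  let e : {i // i ∈ S} ≃ {j // j ∈ T} := Equiv.ofBijective eto ⟨hinj, hsurj⟩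
  have he : ∀ i : {i // i ∈ S}, w (e i).1 = u i.1 := heto
  -- the complementary cell as an injective common-free layout on `Fin r'`
  have hcard : Fintype.card {i // i ∉ S} = Fintype.card {j // j ∉ T} := by
    have h1 : Fintype.card {i // i ∈ S} = Fintype.card {j // j ∈ T} := Fintype.card_congr e
    have h2 : Fintype.card {i // i ∉ S} = Fintype.card (Fin r) - Fintype.card {i // i ∈ S} :=
      Fintype.card_subtype_compl _
    have h3 : Fintype.card {j // j ∉ T} = Fintype.card (Fin r) - Fintype.card {j // j ∈ T} :=
      Fintype.card_subtype_compl _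
    omega
  set r' := Fintype.card {i // i ∉ S} with hr'
  let α : Fin r' ≃ {i // i ∉ S} := (Fintype.equivFin {i // i ∉ S}).symm
  let β : Fin r' ≃ {j // j ∉ T} := (Fintype.equivFinOfCardEq hcard.symm).symm
  have hu' : Function.Injective (fun k : Fin r' => u (α k).1) := fun k l hkl =>
    α.injective (Subtype.ext (hu hkl))
  have hw' : Function.Injective (fun k : Fin r' => w (β k).1) := fun k l hkl =>
    β.injective (Subtype.ext (hw hkl))
  have hfree : ∀ k l : Fin r', u (α k).1 ≠ w (β l).1 := by
    intro k l hkl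
    exact (α k).2 ((hSmem _).mpr ⟨(β l).1, hkl.symm⟩)
  obtain ⟨f₂, hf₂, hdet₂⟩ := hcf h hh₀ r' (fun k => u (α k).1) (fun k => w (β k).1) hu' hw' hfree
  -- transport to the subtype-indexed cell through e' := α.symm.trans β
  let e' : {i // i ∉ S} ≃ {j // j ∉ T} := α.symm.trans β
  have hq : (Matrix.of fun i i' : {i // i ∉ S} => MvPolynomial.coeff
      (∑ a ∈ u i.1, Finsupp.single (Fin.castAdd h a) 1 +
        ∑ c ∈ w (e' i').1, Finsupp.single (Fin.natAdd h c) 1) f₂).det ≠ 0 := by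
    have hsub : (Matrix.of fun i i' : {i // i ∉ S} => MvPolynomial.coeff
        (∑ a ∈ u i.1, Finsupp.single (Fin.castAdd h a) 1 +
          ∑ c ∈ w (e' i').1, Finsupp.single (Fin.natAdd h c) 1) f₂) =
        (Matrix.of fun k l : Fin r' => MvPolynomial.coeff
          (∑ a ∈ u (α k).1, Finsupp.single (Fin.castAdd h a) 1 +
            ∑ c ∈ w (β l).1, Finsupp.single (Fin.natAdd h c) 1) f₂).submatrix α.symm α.symm := by
      ext i i'
      simp only [Matrix.of_apply, Matrix.submatrix_apply, e', Equiv.trans_apply, Equiv.apply_symm_apply]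
    rw [hsub, Matrix.det_submatrix_equiv_self]
    exact hdet₂
  have hf₂' : f₂ ∈ SmallCircuits ℂ (h + h) (max b 2) :=
    ⟨hf₂.1, hf₂.2.trans (Nat.pow_le_pow_right (by omega) (le_max_left _ _))⟩
  exact partitionMinor_hit_of_commonPeel (max b 2) hh2 (le_max_right _ _) u w hu S T e e' he
    (fun i j hij hji => hij ⟨(hSmem i).mpr ⟨j, hji⟩, (hTmem j).mpr ⟨i, hji⟩⟩) f₂ hf₂' hq

end Summit.ValiantsHypothesis.ValiantsHypothesis.Theorems.BarrierLever.MatchedPairs
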